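import Summits.BirchSwinnertonDyer.BirchSwinnertonDyer.Theorems.GenusKolyvaginAtTwoPowDvdShaCardAtTwoRTTransverseIsotropic
import HarnessLib

/-!
# Route `GenusKolyvaginAtTwo`, crux L_T `PowDvdShaCardAtTwoRT` (stmt-BirchSwinnertonDyer-23242), LINE 18/19 stub 3a⁗, step (b) input I7 —
# the VALUES-LEVEL ISOTROPY CRITERION over any number field (for the K-side engine of the LEAD, gk2-p1 g15)

Seat `bsd-line-gk2-p3` g19 (cell `bsd-f1-sign2`), `--supports 23242 --as helper`; sequel of `…RTTransverseIsotropic` (the `ℚ_ℓ` statement).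
THEOREMS ONLY. BSD is not proved by any of this; neither is the crux.

The mechanism of `…RTTransverseIsotropic` is field-independent: if the chosen cocycles of two global classes `x, y ∈ H¹(K, E[n])` take ALL
their values on the decomposition group of the chosen prime over `v` (i.e. on `res Γ_{K_v}`) in a common `e`-ISOTROPIC subset `L ⊆ E[n]`,
then the local Weil cup product `loc_v x ∪ₑ loc_v y ∈ H²(K_v, μₙ)` vanishes — the cup-product `2`-cochain `⟨f b − f a, g c − g b⟩` is
identically zero. Over the Heegner field `K` at a Kolyvagin prime `λ` (trivial action of `Γ_{K_λ}` on `E[2^M]`, cocycles = homomorphisms) this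
is McCallum's Lemma 5.3 (last clause) for EIGEN-transverse classes: a `τ`-eigen transverse class `κ_ℓ ⊗ t` has `t` in ONE of the two isotropic
eigen-lines `ℤ(P ∓ FP)` of the regular module (LEAD's `…RTEigenNorms.exists_eq_zsmul_norm_of_tau_eq` / `…conorm_of_tau_eq_neg`), so two
same-sign transverse classes pair to zero with no Hilbert symbol; over `ℚ_ℓ` it is `cupProduct_localization_eq_zero_of_transverse`.

* `cupProduct_localization_eq_zero_of_h1Eval_mem` — any number field `K`, any `W`, any `n`, any finite place `v`, any subset `L` with
  `e(L, L) = 1`; hypotheses `[x, res g] ∈ L`, `[y, res g] ∈ L` for all `g ∈ Γ_{K_v}`.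
* `cupProduct_localization_eq_zero_of_h1Eval_mem_zmultiples` — the case `L = ℤ·t₀` with `e(t₀, t₀) = 1` (any alternating `e`).
* `inv_cupProduct_localization_eq_zero_of_h1Eval_mem` — the same as the `v`-term of `sum_inv_weilCupProduct_localization_eq_zero`.

References: [McCallumLMS1991] §5 Lemma 5.3; [GrossLMS1991] §7 (7.2); [NeukirchSchmidtWingberg2008] I §4.
-/

set_option autoImplicit false
set_option linter.dupNamespace false -- tree convention: `Summit.BirchSwinnertonDyer.BirchSwinnertonDyer.Theorems` (summit = sub-problem)

noncomputable section
open scoped Classical Pointwise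
universe u

namespace Summit.BirchSwinnertonDyer.BirchSwinnertonDyer.Theorems.GenusExact.TransverseIsotropy

open WeierstrassCurve NumberField IsDedekindDomain Field
open Literature.NumberTheory.EllipticCurves Literature.NumberTheory.GaloisRepresentations
open Literature.NumberTheory.GaloisCohomology

variable {K : Type u} [Field K] [NumberField K] (W : WeierstrassCurve K) {n : ℕ} [NeZero n]
  (v : HeightOneSpectrum (𝓞 K))
  (e : geomTorsion W n → geomTorsion W n → AlgebraicClosure K)
  (hμ : ∀ S T, e S T ^ n = 1) (hadd₁ : ∀ S₁ S₂ T, e (S₁ + S₂) T = e S₁ T * e S₂ T)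
  (hadd₂ : ∀ S T₁ T₂, e S (T₁ + T₂) = e S T₁ * e S T₂)
  (hgal : ∀ (σ : absoluteGaloisGroup K) (S T : geomTorsion W n), σ • e S T = e (σ • S) (σ • T))

/-- **Values-level isotropy criterion (any number field).** If the chosen cocycles of `x, y ∈ H¹(K, E[n])` take all their values on
`res Γ_{K_v}` in a subset `L ⊆ E[n]` on which the pairing `e` is trivial, then the local Weil cup product `loc_v x ∪ₑ loc_v y` vanishes
in `H²(K_v, μₙ)` (the cup-product cochain is identically `0`). [cite: McCallumLMS1991, §5 Lemma 5.3] [cite: NeukirchSchmidtWingberg2008, I §4] -/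
theorem cupProduct_localization_eq_zero_of_h1Eval_mem (L : Set (geomTorsion W (n : ℤ)))
    (hL : ∀ a ∈ L, ∀ b ∈ L, e a b = 1) {x y : galH1Torsion W (n : ℤ)}
    (hx : ∀ g : absoluteGaloisGroup (v.adicCompletion K), h1Eval W (n : ℤ) x (resGal (K := K) (v.adicCompletion K) g) ∈ L)
    (hy : ∀ g : absoluteGaloisGroup (v.adicCompletion K), h1Eval W (n : ℤ) y (resGal (K := K) (v.adicCompletion K) g) ∈ L) :
    haveI := absoluteGaloisGroup_compactSpace (v.adicCompletion K)
    ((weilContPairing W n e hμ hadd₁ hadd₂ hgal).restrict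
      (absGaloisRestrict K (v.adicCompletion K))).cupProduct
        (galoisCohomology.localization (W.torsionGaloisModule ((n : ℕ) : ℤ)) (Sum.inr v) 1 x)
        (galoisCohomology.localization (W.torsionGaloisModule ((n : ℕ) : ℤ)) (Sum.inr v) 1 y) = 0 := by
  haveI := absoluteGaloisGroup_compactSpace (v.adicCompletion K)
  have hx' := galoisCohomology.res_oneCocycleClass (W.torsionGaloisModule ((n : ℕ) : ℤ)) (v.adicCompletion K)
    (reprCocycle W (n : ℤ) x)
  have hy' := galoisCohomology.res_oneCocycleClass (W.torsionGaloisModule ((n : ℕ) : ℤ)) (v.adicCompletion K)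
    (reprCocycle W (n : ℤ) y)
  have hcl : ∀ z : galH1Torsion W (n : ℤ),
      oneCocycleClass ((W.torsionGaloisModule ((n : ℕ) : ℤ)).toTopRep) (reprCocycle W (n : ℤ) z) = z :=
    oneCocycleClass_reprCocycle W (n : ℤ)
  rw [hcl] at hx' hy'
  change ((weilContPairing W n e hμ hadd₁ hadd₂ hgal).restrict (absGaloisRestrict K (v.adicCompletion K))).cupProduct
      (galoisCohomology.res (W.torsionGaloisModule ((n : ℕ) : ℤ)) (v.adicCompletion K) 1 x)
      (galoisCohomology.res (W.torsionGaloisModule ((n : ℕ) : ℤ)) (v.adicCompletion K) 1 y) = 0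
  rw [hx', hy']
  refine cupProduct_oneCocycleClass_eq_zero_of_toLin_apply_eq_zero _ _ _ fun a b ↦ ?_
  change weilPairingHom W n e hμ hadd₁ hadd₂
      (h1Eval W (n : ℤ) x (resGal (K := K) (v.adicCompletion K) a))
      (h1Eval W (n : ℤ) y (resGal (K := K) (v.adicCompletion K) b)) = 0
  rw [muCarrier_eq_iff, coe_weilPairingHom, hL _ (hx a) _ (hy b)]
  rfl

/-- **The case of a common isotropic LINE `L = ℤ·t₀`** (`e(t₀, t₀) = 1`, `e` biadditive): values `[x, res g], [y, res g] ∈ ℤ t₀`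
⟹ `loc_v x ∪ₑ loc_v y = 0`. Over the Heegner field at a Kolyvagin prime this is McCallum's Lemma 5.3 (last clause) for two
`τ`-eigen transverse classes of the same sign (`t₀ = P ∓ FP`). [cite: McCallumLMS1991, §5 Lemma 5.3] -/
theorem cupProduct_localization_eq_zero_of_h1Eval_mem_zmultiples (halt : ∀ T, e T T = 1) (t₀ : geomTorsion W (n : ℤ))
    {x y : galH1Torsion W (n : ℤ)}
    (hx : ∀ g : absoluteGaloisGroup (v.adicCompletion K), ∃ k : ℤ,
      h1Eval W (n : ℤ) x (resGal (K := K) (v.adicCompletion K) g) = k • t₀)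
    (hy : ∀ g : absoluteGaloisGroup (v.adicCompletion K), ∃ k : ℤ,
      h1Eval W (n : ℤ) y (resGal (K := K) (v.adicCompletion K) g) = k • t₀) :
    haveI := absoluteGaloisGroup_compactSpace (v.adicCompletion K)
    ((weilContPairing W n e hμ hadd₁ hadd₂ hgal).restrict
      (absGaloisRestrict K (v.adicCompletion K))).cupProduct
        (galoisCohomology.localization (W.torsionGaloisModule ((n : ℕ) : ℤ)) (Sum.inr v) 1 x)
        (galoisCohomology.localization (W.torsionGaloisModule ((n : ℕ) : ℤ)) (Sum.inr v) 1 y) = 0 := by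
  refine cupProduct_localization_eq_zero_of_h1Eval_mem W v e hμ hadd₁ hadd₂ hgal
    {t | ∃ k : ℤ, t = k • t₀} (fun a ha b hb ↦ ?_) (fun g ↦ hx g) (fun g ↦ hy g)
  obtain ⟨k, rfl⟩ := ha
  obtain ⟨k', rfl⟩ := hb
  -- `e (k t₀) (k' t₀) = 1`, read additively through `weilPairingHom`
  have h : weilPairingHom W n e hμ hadd₁ hadd₂ (k • t₀) (k' • t₀) = 0 := by
    calc weilPairingHom W n e hμ hadd₁ hadd₂ (k • t₀) (k' • t₀)
        = k' • weilPairingHom W n e hμ hadd₁ hadd₂ (k • t₀) t₀ := map_zsmul _ _ _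
      _ = k' • k • weilPairingHom W n e hμ hadd₁ hadd₂ t₀ t₀ := by
          rw [← AddMonoidHom.flip_apply (weilPairingHom W n e hμ hadd₁ hadd₂) (k • t₀) t₀, map_zsmul,
            AddMonoidHom.flip_apply]
      _ = 0 := by rw [weilPairingHom_self W n e hμ hadd₁ hadd₂ halt, smul_zero, smul_zero]
  have h' := muCarrier_eq_iff.mp h
  rw [coe_weilPairingHom] at h'
  exact h'

/-- **The `v`-term of the Poitou–Tate sum vanishes** under the values-level criterion (`inv`-form, the shape of the terms of
`sum_inv_weilCupProduct_localization_eq_zero`). [cite: McCallumLMS1991, §5 proof of Prop. 5.2 (13)] -/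
theorem inv_cupProduct_localization_eq_zero_of_h1Eval_mem (inv : LocalInvariants K n) (L : Set (geomTorsion W (n : ℤ)))
    (hL : ∀ a ∈ L, ∀ b ∈ L, e a b = 1) {x y : galH1Torsion W (n : ℤ)}
    (hx : ∀ g : absoluteGaloisGroup (v.adicCompletion K), h1Eval W (n : ℤ) x (resGal (K := K) (v.adicCompletion K) g) ∈ L)
    (hy : ∀ g : absoluteGaloisGroup (v.adicCompletion K), h1Eval W (n : ℤ) y (resGal (K := K) (v.adicCompletion K) g) ∈ L) :
    haveI := absoluteGaloisGroup_compactSpace (Place.Completion (Sum.inr v : Place K))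
    inv (Sum.inr v) ((weilContPairingLocal W n e hμ hadd₁ hadd₂ hgal (Sum.inr v)).cupProduct
      (galoisCohomology.localization (W.torsionGaloisModule ((n : ℕ) : ℤ)) (Sum.inr v) 1 x)
      (galoisCohomology.localization (W.torsionGaloisModule ((n : ℕ) : ℤ)) (Sum.inr v) 1 y)) = 0 := by
  haveI := absoluteGaloisGroup_compactSpace (Place.Completion (Sum.inr v : Place K))
  have h := cupProduct_localization_eq_zero_of_h1Eval_mem W v e hμ hadd₁ hadd₂ hgal L hL hx hy
  have h' : (weilContPairingLocal W n e hμ hadd₁ hadd₂ hgal (Sum.inr v)).cupProduct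
      (galoisCohomology.localization (W.torsionGaloisModule ((n : ℕ) : ℤ)) (Sum.inr v) 1 x)
      (galoisCohomology.localization (W.torsionGaloisModule ((n : ℕ) : ℤ)) (Sum.inr v) 1 y) = 0 := h
  rw [h']
  exact map_zero _

/-! ## Appendix (g19, same session): the K_λ form at a prime where the decomposition group fixes `E[n]` (LEAD's ask, STATUS 02:48Z)

Over the Heegner field `K` at a Kolyvagin prime `λ` (and more generally whenever an arithmetic Frobenius `F` at the chosen prime `𝔓 ∣ v`
and the inertia group `I_𝔓` both fix `T = E[n]`), the restricted cocycle of `x ∈ H¹(K, E[n])` is a homomorphism on `G_𝔓 = ⟨F⟩·I_𝔓·U`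
and its values are `k·[x, F] + [x, i]`. So if `[x, F]` and all tame values `[x, σ]` (`σ ∈ I_𝔓`) lie in a line `ℤ t₀` with `e(t₀, t₀) = 1`,
and likewise for `y` with the SAME line, then `loc_v x ∪ₑ loc_v y = 0`. This is McCallum's Lemma 5.3 (last clause) over `K_λ` at `p = 2`
for two `τ`-eigen transverse classes of the same sign (`t₀ = P ∓ FP`, LEAD's `…RTEigenNorms`), and it also covers a transverse and an
unramified class of OPPOSITE signs (both value sets in the same eigen-line). The full two-dimensional `im χ_ℓ` over `K_λ` (opposite-sign
transverse pairs) is the Hilbert-symbol identity `(ℓ, −1)_{λ,2^M} = 1` — not needed by the engines and not proved here. -/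

/-- **K_λ form of the isotropy criterion (decomposition group fixing `E[n]`).** `K` any number field, `v` finite, `𝔓` the prime of the
chosen embedding, `F` an arithmetic Frobenius at `𝔓` FIXING `E[n]`, `Γ_{K(E[n])}` open (the tame values enter only through the hypotheses); `t₀ ∈ E[n]` with `e(t₀,t₀) = 1`.
If `[x, F], [y, F] ∈ ℤ t₀` and all tame values `[x, σ], [y, σ]` (`σ ∈ I_𝔓`) lie in `ℤ t₀`, then `loc_v x ∪ₑ loc_v y = 0` in `H²(K_v, μₙ)`.
[cite: McCallumLMS1991, §5 Lemma 5.3] [cite: GrossLMS1991, §9 Prop. 9.6] -/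
theorem cupProduct_localization_eq_zero_of_values_in_line (halt : ∀ T, e T T = 1)
    {𝔐 : Ideal (HeightOneSpectrum.localAbsIntegers v)} (h𝔐 : 𝔐 ∈ v.localPrimesAbove)
    {F : absoluteGaloisGroup K}
    (hFrob : IsArithFrobAt (𝓞 K) F (v.primeBelow (closureEmb (K := K) (v.adicCompletion K)) 𝔐))
    (hFfix : F ∈ torsionFixing W (n : ℤ))
    (hopen : IsOpen (torsionFixing W (n : ℤ) : Set (absoluteGaloisGroup K)))
    (t₀ : geomTorsion W (n : ℤ)) {x y : galH1Torsion W (n : ℤ)}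
    (hxF : ∃ k : ℤ, h1Eval W (n : ℤ) x F = k • t₀) (hyF : ∃ k : ℤ, h1Eval W (n : ℤ) y F = k • t₀)
    (hxI : ∀ σ ∈ (v.primeBelow (closureEmb (K := K) (v.adicCompletion K)) 𝔐).inertia (absoluteGaloisGroup K),
      ∃ k : ℤ, h1Eval W (n : ℤ) x σ = k • t₀)
    (hyI : ∀ σ ∈ (v.primeBelow (closureEmb (K := K) (v.adicCompletion K)) 𝔐).inertia (absoluteGaloisGroup K),
      ∃ k : ℤ, h1Eval W (n : ℤ) y σ = k • t₀) :
    haveI := absoluteGaloisGroup_compactSpace (v.adicCompletion K)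
    ((weilContPairing W n e hμ hadd₁ hadd₂ hgal).restrict
      (absGaloisRestrict K (v.adicCompletion K))).cupProduct
        (galoisCohomology.localization (W.torsionGaloisModule ((n : ℕ) : ℤ)) (Sum.inr v) 1 x)
        (galoisCohomology.localization (W.torsionGaloisModule ((n : ℕ) : ℤ)) (Sum.inr v) 1 y) = 0 := by
  set ι₀ := closureEmb (K := K) (v.adicCompletion K) with hι₀
  set 𝔓 := v.primeBelow ι₀ 𝔐 with h𝔓def
  have h𝔓 : 𝔓 ∈ v.primesAbove := HeightOneSpectrum.primeBelow_mem_primesAbove h𝔐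
  haveI : 𝔓.IsPrime := h𝔓.1
  -- the values on the decomposition group of a class whose Frobenius value and tame values lie in `ℤ t₀`
  have key : ∀ z : galH1Torsion W (n : ℤ), (∃ k : ℤ, h1Eval W (n : ℤ) z F = k • t₀) →
      (∀ σ ∈ 𝔓.inertia (absoluteGaloisGroup K), ∃ k : ℤ, h1Eval W (n : ℤ) z σ = k • t₀) →
      ∀ g : absoluteGaloisGroup (v.adicCompletion K), ∃ k : ℤ,
        h1Eval W (n : ℤ) z (resGal (K := K) (v.adicCompletion K) g) = k • t₀ := by
    intro z hzF hzI g
    obtain ⟨k₀, hk₀⟩ := hzF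
    have hd : resGal (K := K) (v.adicCompletion K) g ∈ 𝔓.decompositionSubgroup (absoluteGaloisGroup K) := by
      rw [resGal_eq]; exact resGalOfEmb_mem_decompositionSubgroup ι₀ h𝔐 g
    obtain ⟨m, i, w, hi, hw, hdec⟩ :=
      exists_eq_frobenius_pow_mul_of_mem_decompositionSubgroup h𝔓 hFrob
        (isOpen_evalKer W (n : ℤ) (fun _ : Unit ↦ z) hopen) hd
    obtain ⟨k₁, hk₁⟩ := hzI i hi
    -- `[z, F^m] = m k₀ t₀` (`F` fixes `T`)
    have hpow : ∀ j : ℕ, h1Eval W (n : ℤ) z (F ^ j) = ((j : ℤ) * k₀) • t₀ := by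
      intro j
      induction j with
      | zero => rw [pow_zero, h1Eval_one, Nat.cast_zero, zero_mul, zero_smul]
      | succ j ih =>
        rw [pow_succ, h1Eval_mul W (n : ℤ) z (Subgroup.pow_mem _ hFfix j), ih, hk₀, ← add_smul, Nat.cast_succ,
          add_mul, one_mul]
    refine ⟨(m : ℤ) * k₀ + k₁, ?_⟩
    rw [hdec, FrobeniusCriterion.h1Eval_mul_smul, FrobeniusCriterion.h1Eval_mul_smul, hw.2 (), smul_zero, add_zero,
      hpow m, hk₁,
      smul_eq_of_mem_torsionFixing W (n : ℤ) (Subgroup.pow_mem _ hFfix m), add_smul]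
  exact cupProduct_localization_eq_zero_of_h1Eval_mem_zmultiples W v e hμ hadd₁ hadd₂ hgal halt t₀
    (key x hxF hxI) (key y hyF hyI)

end Summit.BirchSwinnertonDyer.BirchSwinnertonDyer.Theorems.GenusExact.TransverseIsotropy

end
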